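import Summits.NavierStokesRegularity.FluidComputer.HighRows
import Summits.NavierStokesRegularity.FluidComputer.SuperLadderOptimisation
import Summits.NavierStokesRegularity.FluidComputer.CriticalLevels
import HarnessLib

/-!
# Fluid computer — support: the `Ḃ^{5/2}_{2,1}` row is interpolated between the energy and a high row,
# `∑_l 2^{5l/2} ‖Δ̇_l v‖₂ ≤ C_κ ‖v‖₂^{(κ−5)/κ} (∑_j 2^{κj} ‖Δ̇_j v‖₂²)^{5/(2κ)}`, `κ > 5`

HONEST FRAMING (cell `pub-fluidc`, verbatim): *low prior, high value-of-information experiment on Tao's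
machine paradigm; NOT a claim that NS blows up.* Support file (pure bookkeeping; no blow-up content). The Lipschitz row
`R = ∑_l 2^l ‖Δ̇_l v‖_∞` of `LipschitzSummation` is at most `C_B ∑_l 2^{5l/2} ‖Δ̇_l v‖₂` (Bernstein); this file bounds the
latter (`Ḃ^{5/2}_{2,1}` size) by the energy and the `Ḃ^{κ/2}_{2,2}` row for `κ > 5` — Robinson–Sadowski–Silva's
interpolation `‖u‖_{F¹} ≤ c ‖u‖_{L²}^{1−5/(2s)} ‖u‖_{Ḣ^s}^{5/(2s)}` (`s = κ/2 > 5/2`, their (3.10)) in dyadic currency: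

* `dyadic_optimisation_p` — real bookkeeping, the optimisation over the splitting level at a general head exponent `p`:
  `a ≤ α 2^{pJ} + β 2^{−θJ} √d` for every `J ∈ ℤ` forces `a^{2+2θ/p} ≤ 2^{2+2θ+2θ/p} α^{2θ/p} β² d`
  (`SuperLadderOptimisation.dyadic_optimisation_gen` is `p = 3/2`);
* `tsum_tail_le_sqrt_52` — Cauchy–Schwarz above a level: `∑_{n≥0} 2^{5(J+n)/2} a_{J+n} ≤ (2^{(5−2σ)J} G_σ)^{1/2}
  (∑_n 2^{2σ(J+n)} a_{J+n}²)^{1/2}`, `G_σ = ∑_n (2^{5−2σ})^n < ∞` for `σ > 5/2` (`geom_lt_top_of_neg`);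
* `lipRow_le_head_add_tail`, `lipRow_ne_top`, `lipRow_le_interpolate` — for `v ∈ L²` with finite `κ`-row (`κ > 5`):
  `∑_l 2^{5l/2} a_l ≤ C₂‖v‖₂ 2^{5(J−1)/2} G + (2^{(5−κ)J} G_{κ/2})^{1/2} Y_κ^{1/2}` at every `J`, the row is finite, and
  `(∑_l 2^{5l/2} a_l) ≤ C_κ · ‖v‖₂^{(κ−5)/κ} · Y_κ^{5/(2κ)}` (real numbers).

0 sorry; no definitions; no named facts.

## References

* J. C. Robinson, W. Sadowski, R. P. Silva, J. Math. Phys. 53 (2012) 115618, §III (3.10), §VI (6.3). [RobinsonSadowskiSilva2012]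
* H. Bahouri, J.-Y. Chemin, R. Danchin, Grundlehren 343 (2011), Prop. 2.22 (interpolation in Besov scales). [BahouriCheminDanchin2011]
-/

noncomputable section

open MeasureTheory Set Function Filter Topology
open scoped ENNReal NNReal
open Literature.Analysis.FluidPDE Literature.Analysis.FunctionSpaces
open Summit.NavierStokesRegularity.FluidComputer.SobolevLadderFront (tsum_ladder_low_le tsum_geom_lt_top)
open Summit.NavierStokesRegularity.FluidComputer.CriticalLevels (tsum_int_eq_low_add_tail)

namespace Summit.NavierStokesRegularity.FluidComputer.LipschitzRowInterpolation

/-! ## The optimisation over the splitting level, general head exponent -/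

/-- **Dyadic optimisation, general head exponent** (real bookkeeping): if `a ≤ α 2^{pJ} + β 2^{−θJ} √d` for EVERY
`J ∈ ℤ`, with `a, β, θ, p > 0` and `α, d ≥ 0`, then `a^{2+2θ/p} ≤ 2^{2+2θ+2θ/p} α^{2θ/p} β² d` (choose `J` with
`2^J ≤ (a/(2α))^{1/p} < 2^{J+1}`). [folklore] -/
theorem dyadic_optimisation_p {a α β d θ p : ℝ} (ha : 0 < a) (hα : 0 ≤ α) (hβ : 0 < β) (hd : 0 ≤ d) (hθ : 0 < θ)
    (hp : 0 < p) (h : ∀ J : ℤ, a ≤ α * (2 : ℝ) ^ (p * J) + β * (2 : ℝ) ^ (-θ * J) * Real.sqrt d) :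
    a ^ (2 + 2 * θ / p) ≤ (2 : ℝ) ^ (2 + 2 * θ + 2 * θ / p) * α ^ (2 * θ / p) * β ^ 2 * d := by
  rcases hα.eq_or_lt with hα0 | hαpos
  · -- `α = 0`: the hypothesis fails for large `J`
    exfalso
    obtain ⟨n, hn⟩ := pow_unbounded_of_one_lt (β * Real.sqrt d / a) (by norm_num : (1 : ℝ) < 2)
    set J : ℤ := ⌈(n : ℝ) / θ⌉ with hJdef
    have hJ := h J
    rw [← hα0, zero_mul, zero_add] at hJ
    have hθJ : (n : ℝ) ≤ θ * J := by
      have := Int.le_ceil ((n : ℝ) / θ)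
      rw [hJdef]
      rw [div_le_iff₀ hθ] at this
      linarith
    have hpow : (2 : ℝ) ^ (-θ * J) ≤ ((2 : ℝ) ^ n)⁻¹ := by
      rw [← Real.rpow_natCast, ← Real.rpow_neg (by norm_num : (0 : ℝ) ≤ 2)]
      exact Real.rpow_le_rpow_of_exponent_le (by norm_num) (by linarith)
    have h2n : (0 : ℝ) < 2 ^ n := by positivity
    have hJ' : a * 2 ^ n ≤ β * Real.sqrt d := by
      have h1 : a ≤ β * ((2 : ℝ) ^ n)⁻¹ * Real.sqrt d :=
        hJ.trans (mul_le_mul_of_nonneg_right (mul_le_mul_of_nonneg_left hpow hβ.le) (Real.sqrt_nonneg _))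
      rw [show β * ((2 : ℝ) ^ n)⁻¹ * Real.sqrt d = β * Real.sqrt d / 2 ^ n by ring] at h1
      rwa [le_div_iff₀ h2n] at h1
    rw [div_lt_iff₀ ha, show (2 : ℝ) ^ n * a = a * 2 ^ n by ring] at hn
    exact absurd (hJ'.trans_lt hn) (lt_irrefl _)
  · -- `α > 0`: choose the level
    set x : ℝ := (a / (2 * α)) ^ (1 / p) with hx
    have hx0 : 0 < x := by positivity
    set J : ℤ := ⌊Real.logb 2 x⌋ with hJdef
    have h2J : (2 : ℝ) ^ (J : ℝ) ≤ x := by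
      calc (2 : ℝ) ^ (J : ℝ) ≤ (2 : ℝ) ^ Real.logb 2 x :=
            Real.rpow_le_rpow_of_exponent_le (by norm_num) (Int.floor_le _)
        _ = x := Real.rpow_logb two_pos (by norm_num) hx0
    have hxJ : x < (2 : ℝ) ^ ((J : ℝ) + 1) := by
      calc x = (2 : ℝ) ^ Real.logb 2 x := (Real.rpow_logb two_pos (by norm_num) hx0).symm
        _ < (2 : ℝ) ^ ((J : ℝ) + 1) :=
            Real.rpow_lt_rpow_of_exponent_lt (by norm_num) (Int.lt_floor_add_one _)
    -- head ≤ a/2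
    have hhead : α * (2 : ℝ) ^ (p * J) ≤ a / 2 := by
      have h1 : (2 : ℝ) ^ (p * J) = ((2 : ℝ) ^ (J : ℝ)) ^ p := by
        rw [← Real.rpow_mul (by norm_num)]
        congr 1
        ring
      have h2 : ((2 : ℝ) ^ (J : ℝ)) ^ p ≤ x ^ p := Real.rpow_le_rpow (by positivity) h2J hp.le
      have h3 : x ^ p = a / (2 * α) := by
        rw [hx, ← Real.rpow_mul (by positivity), one_div_mul_cancel hp.ne', Real.rpow_one]
      rw [h1]
      calc α * ((2 : ℝ) ^ (J : ℝ)) ^ p ≤ α * (a / (2 * α)) := by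
            rw [← h3]; exact mul_le_mul_of_nonneg_left h2 hα
        _ = a / 2 := by field_simp
    -- hence the tail is ≥ a/2
    have htail : a / 2 ≤ β * (2 : ℝ) ^ (-θ * J) * Real.sqrt d := by linarith [h J]
    have hsq : (a / 2) ^ 2 ≤ β ^ 2 * (2 : ℝ) ^ (-(2 * θ) * J) * d := by
      have e : (β * (2 : ℝ) ^ (-θ * J) * Real.sqrt d) ^ 2 = β ^ 2 * (2 : ℝ) ^ (-(2 * θ) * J) * d := by
        rw [mul_pow, mul_pow, Real.sq_sqrt hd, ← Real.rpow_natCast ((2 : ℝ) ^ (-θ * J)),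
          ← Real.rpow_mul (by norm_num)]
        congr 2
        push_cast
        ring
      rw [← e]
      exact pow_le_pow_left₀ (by positivity) htail 2
    have h2Jx : x / 2 < (2 : ℝ) ^ (J : ℝ) := by
      rw [Real.rpow_add_one (by norm_num)] at hxJ
      linarith
    have hθ2 : 0 ≤ 2 * θ := by linarith
    have hpow2θ : (x / 2) ^ (2 * θ) ≤ (2 : ℝ) ^ ((2 * θ) * J) := by
      have e : (2 : ℝ) ^ ((2 * θ) * J) = ((2 : ℝ) ^ (J : ℝ)) ^ (2 * θ) := by
        rw [← Real.rpow_mul (by norm_num)]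
        congr 1
        ring
      rw [e]
      exact Real.rpow_le_rpow (div_pos hx0 two_pos).le h2Jx.le hθ2
    have hneg : (2 : ℝ) ^ (-(2 * θ) * J) = ((2 : ℝ) ^ ((2 * θ) * J))⁻¹ := by
      rw [show -(2 * θ) * (J : ℝ) = -((2 * θ) * J) by ring, Real.rpow_neg (by norm_num)]
    have h22pos : 0 < (2 : ℝ) ^ ((2 * θ) * J) := by positivity
    have hmain : (a / 2) ^ 2 * (x / 2) ^ (2 * θ) ≤ β ^ 2 * d := by
      have h1 : (a / 2) ^ 2 * (2 : ℝ) ^ ((2 * θ) * J) ≤ β ^ 2 * d := by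
        rw [hneg] at hsq
        calc (a / 2) ^ 2 * (2 : ℝ) ^ ((2 * θ) * J) ≤ β ^ 2 * ((2 : ℝ) ^ ((2 * θ) * J))⁻¹ * d * (2 : ℝ) ^ ((2 * θ) * J) :=
              mul_le_mul_of_nonneg_right hsq h22pos.le
          _ = β ^ 2 * d := by field_simp
      exact le_trans (mul_le_mul_of_nonneg_left hpow2θ (by positivity)) h1
    -- `(x/2)^{2θ} = x^{2θ}/2^{2θ}`, `x^{2θ} = a^{2θ/p}/(2α)^{2θ/p}`, `(2α)^{2θ/p} = 2^{2θ/p} α^{2θ/p}`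
    have hx2θ : (x / 2) ^ (2 * θ) =
        a ^ (2 * θ / p) / ((2 : ℝ) ^ (2 * θ / p) * α ^ (2 * θ / p) * (2 : ℝ) ^ (2 * θ)) := by
      rw [Real.div_rpow hx0.le (by norm_num), hx, ← Real.rpow_mul (by positivity),
        Real.div_rpow ha.le (by positivity), Real.mul_rpow (by norm_num) hα,
        show (1 / p : ℝ) * (2 * θ) = 2 * θ / p by ring]
      field_simp
    have ha2 : a ^ (2 + 2 * θ / p) = a ^ 2 * a ^ (2 * θ / p) := by
      rw [Real.rpow_add ha, Real.rpow_two]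
    have h2exp : (2 : ℝ) ^ (2 + 2 * θ + 2 * θ / p) = 4 * ((2 : ℝ) ^ (2 * θ / p) * (2 : ℝ) ^ (2 * θ)) := by
      rw [← Real.rpow_add two_pos, show (2 : ℝ) + 2 * θ + 2 * θ / p = 2 + (2 * θ / p + 2 * θ) by ring,
        Real.rpow_add two_pos, Real.rpow_two]
      norm_num
    rw [hx2θ] at hmain
    have hpos1 : 0 < (2 : ℝ) ^ (2 * θ / p) * α ^ (2 * θ / p) * (2 : ℝ) ^ (2 * θ) := by positivity
    rw [show (a / 2) ^ 2 * (a ^ (2 * θ / p) / ((2 : ℝ) ^ (2 * θ / p) * α ^ (2 * θ / p) * (2 : ℝ) ^ (2 * θ))) =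
        a ^ 2 * a ^ (2 * θ / p) / (4 * ((2 : ℝ) ^ (2 * θ / p) * α ^ (2 * θ / p) * (2 : ℝ) ^ (2 * θ))) by
          field_simp; ring,
      div_le_iff₀ (by positivity)] at hmain
    rw [ha2, h2exp]
    calc a ^ 2 * a ^ (2 * θ / p) ≤ β ^ 2 * d * (4 * ((2 : ℝ) ^ (2 * θ / p) * α ^ (2 * θ / p) * (2 : ℝ) ^ (2 * θ))) :=
          hmain
      _ = 4 * ((2 : ℝ) ^ (2 * θ / p) * (2 : ℝ) ^ (2 * θ)) * α ^ (2 * θ / p) * β ^ 2 * d := by ring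

/-! ## Cauchy–Schwarz above a level at the exponent `5/2` -/

/-- **Cauchy–Schwarz over a tail of levels at `5/2`**: for any `σ`, any sequence `a : ℤ → [0, ∞]` and `J ∈ ℤ`,
`∑_{n≥0} 2^{5(J+n)/2} a_{J+n} ≤ (2^{(5−2σ)J} G_σ)^{1/2} (∑_{n≥0} 2^{2σ(J+n)} a_{J+n}²)^{1/2}`, `G_σ = ∑_n (2^{5−2σ})^n`
(`2^{5x/2} = 2^{(5/2−σ)x}·2^{σx}`; Hölder on the counting measure; `SuperLadder.tsum_tail_le_sqrt_gen` is the exponent `3/2`).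
[folklore] -/
theorem tsum_tail_le_sqrt_52 (a : ℤ → ℝ≥0∞) (J : ℤ) (σ : ℝ) :
    ∑' n : ℕ, (2 : ℝ≥0∞) ^ ((5 / 2 : ℝ) * ((J + n : ℤ) : ℝ)) * a (J + n) ≤
      ((2 : ℝ≥0∞) ^ ((5 - 2 * σ) * (J : ℝ)) * ∑' n : ℕ, ((2 : ℝ≥0∞) ^ (5 - 2 * σ)) ^ n) ^ (1 / 2 : ℝ) *
        (∑' n : ℕ, (2 : ℝ≥0∞) ^ ((2 * σ) * ((J + n : ℤ) : ℝ)) * a (J + n) ^ 2) ^ (1 / 2 : ℝ) := by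
  set f : ℕ → ℝ≥0∞ := fun n => (2 : ℝ≥0∞) ^ ((5 / 2 - σ) * ((J + n : ℤ) : ℝ)) with hf
  set g : ℕ → ℝ≥0∞ := fun n => (2 : ℝ≥0∞) ^ (σ * ((J + n : ℤ) : ℝ)) * a (J + n) with hg
  have h2 : (2 : ℝ≥0∞) ≠ 0 := two_ne_zero
  have h2' : (2 : ℝ≥0∞) ≠ ⊤ := ENNReal.ofNat_ne_top
  have hfg : ∀ n, f n * g n = (2 : ℝ≥0∞) ^ ((5 / 2 : ℝ) * ((J + n : ℤ) : ℝ)) * a (J + n) := by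
    intro n
    simp only [hf, hg]
    rw [← mul_assoc, ← ENNReal.rpow_add _ _ h2 h2']
    congr 2
    ring
  have hH := ENNReal.lintegral_mul_le_Lp_mul_Lq (Measure.count : Measure ℕ) Real.HolderConjugate.two_two
    (measurable_from_nat (f := f)).aemeasurable (measurable_from_nat (f := g)).aemeasurable
  rw [lintegral_count, lintegral_count, lintegral_count] at hH
  simp only [Pi.mul_apply] at hH
  have hf2 : ∑' n : ℕ, f n ^ (2 : ℝ) = (2 : ℝ≥0∞) ^ ((5 - 2 * σ) * (J : ℝ)) * ∑' n : ℕ, ((2 : ℝ≥0∞) ^ (5 - 2 * σ)) ^ n := by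
    have hterm : ∀ n : ℕ, f n ^ (2 : ℝ) = (2 : ℝ≥0∞) ^ ((5 - 2 * σ) * (J : ℝ)) * ((2 : ℝ≥0∞) ^ (5 - 2 * σ)) ^ n := by
      intro n
      simp only [hf]
      rw [← ENNReal.rpow_mul, ← ENNReal.rpow_natCast, ← ENNReal.rpow_mul, ← ENNReal.rpow_add _ _ h2 h2']
      congr 1
      push_cast
      ring
    rw [tsum_congr hterm, ENNReal.tsum_mul_left]
  have hg2 : ∑' n : ℕ, g n ^ (2 : ℝ) = ∑' n : ℕ, (2 : ℝ≥0∞) ^ ((2 * σ) * ((J + n : ℤ) : ℝ)) * a (J + n) ^ 2 := by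
    refine tsum_congr fun n => ?_
    simp only [hg]
    rw [ENNReal.mul_rpow_of_nonneg _ _ (by norm_num : (0 : ℝ) ≤ 2), ← ENNReal.rpow_mul, ENNReal.rpow_two]
    congr 2
    ring
  calc ∑' n : ℕ, (2 : ℝ≥0∞) ^ ((5 / 2 : ℝ) * ((J + n : ℤ) : ℝ)) * a (J + n)
      = ∑' n : ℕ, f n * g n := tsum_congr fun n => (hfg n).symm
    _ ≤ (∑' n : ℕ, f n ^ (2 : ℝ)) ^ (1 / (2 : ℝ)) * (∑' n : ℕ, g n ^ (2 : ℝ)) ^ (1 / (2 : ℝ)) := hH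
    _ = _ := by rw [hf2, hg2]

/-- A geometric series `∑_n (2^c)^n` with `c < 0` is finite (the factor `G_{κ/2} = ∑_n (2^{5−κ})^n`, `κ > 5`).
[folklore] -/
theorem geom_lt_top_of_neg {c : ℝ} (hc : c < 0) : ∑' n : ℕ, ((2 : ℝ≥0∞) ^ c) ^ n < ∞ := by
  rw [ENNReal.tsum_geometric, ENNReal.inv_lt_top, tsub_pos_iff_lt]
  exact ENNReal.rpow_lt_one_of_one_lt_of_neg (by norm_num) hc

/-! ## The `Ḃ^{5/2}_{2,1}` row between the energy and a high row -/

/-- **The `Ḃ^{5/2}_{2,1}` row split at a level.** For `v ∈ L²` on `ℝ³`, every `κ` and every `J ∈ ℤ`: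
`∑_l 2^{5l/2} ‖Δ̇_l v‖₂ ≤ C₂ ‖v‖₂ 2^{5(J−1)/2} G + (2^{(5−κ)J} G_{κ/2})^{1/2} (∑_j 2^{κj} ‖Δ̇_j v‖₂²)^{1/2}`,
`G = ∑_n 2^{−5n/2}`, `G_{κ/2} = ∑_n (2^{5−κ})^n` (the levels below `J` by the energy, `tsum_ladder_low_le`; the levels
above by `tsum_tail_le_sqrt_52` and the tail of the row by the whole row). [cite: RobinsonSadowskiSilva2012, §III (3.10)]
[cite: BahouriCheminDanchin2011, Prop. 2.22] -/
theorem lipRow_le_head_add_tail {v : EuclideanSpace ℝ (Fin 3) → EuclideanSpace ℝ (Fin 3)}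
    (hv : MemLp v 2 volume) (κ : ℝ) (J : ℤ) :
    ∑' l : ℤ, (2 : ℝ≥0∞) ^ ((5 / 2 : ℝ) * (l : ℝ)) * blockL2 v l ≤
      ((lpBounds (Fin 3)).C₂ : ℝ≥0∞) * eLpNorm v 2 volume * (2 : ℝ≥0∞) ^ ((5 / 2 : ℝ) * ((J - 1 : ℤ) : ℝ)) *
          (∑' n : ℕ, ((2 : ℝ≥0∞) ^ (-(5 / 2 : ℝ))) ^ n) +
        ((2 : ℝ≥0∞) ^ ((5 - κ) * (J : ℝ)) * ∑' n : ℕ, ((2 : ℝ≥0∞) ^ (5 - κ)) ^ n) ^ (1 / 2 : ℝ) *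
          (∑' j : ℤ, (2 : ℝ≥0∞) ^ (κ * (j : ℝ)) * blockL2 v j ^ 2) ^ (1 / 2 : ℝ) := by
  rw [tsum_int_eq_low_add_tail (fun l => (2 : ℝ≥0∞) ^ ((5 / 2 : ℝ) * (l : ℝ)) * blockL2 v l) J]
  refine add_le_add (tsum_ladder_low_le hv J) ?_
  have h := tsum_tail_le_sqrt_52 (blockL2 v) J (κ / 2)
  rw [show 2 * (κ / 2) = κ by ring] at h
  refine h.trans (mul_le_mul' le_rfl (ENNReal.rpow_le_rpow ?_ (by norm_num)))
  exact ENNReal.tsum_comp_le_tsum_of_injective (f := fun n : ℕ => J + (n : ℤ))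
    (fun x y hxy => by simpa using hxy) (fun j => (2 : ℝ≥0∞) ^ (κ * (j : ℝ)) * blockL2 v j ^ 2)

/-- **The `Ḃ^{5/2}_{2,1}` row is finite** when `v ∈ L²` and some row `κ > 5` is finite. [folklore] -/
theorem lipRow_ne_top {v : EuclideanSpace ℝ (Fin 3) → EuclideanSpace ℝ (Fin 3)}
    (hv : MemLp v 2 volume) {κ : ℝ} (hκ : 5 < κ)
    (hY : ∑' j : ℤ, (2 : ℝ≥0∞) ^ (κ * (j : ℝ)) * blockL2 v j ^ 2 ≠ ∞) :
    ∑' l : ℤ, (2 : ℝ≥0∞) ^ ((5 / 2 : ℝ) * (l : ℝ)) * blockL2 v l ≠ ∞ := by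
  have h := lipRow_le_head_add_tail hv κ 0
  refine ne_top_of_le_ne_top (ENNReal.add_ne_top.2 ⟨?_, ?_⟩) h
  · exact ENNReal.mul_ne_top (ENNReal.mul_ne_top (ENNReal.mul_ne_top ENNReal.coe_ne_top hv.eLpNorm_ne_top)
      (RiccatiSlice.two_rpow_ne_top _)) (tsum_geom_lt_top (by norm_num)).ne
  · exact ENNReal.mul_ne_top (ENNReal.rpow_ne_top_of_nonneg (by norm_num)
      (ENNReal.mul_ne_top (RiccatiSlice.two_rpow_ne_top _) (geom_lt_top_of_neg (by linarith : 5 - κ < 0)).ne))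
      (ENNReal.rpow_ne_top_of_nonneg (by norm_num) hY)

/-- **THE `Ḃ^{5/2}_{2,1}` ROW INTERPOLATED BETWEEN THE ENERGY AND A HIGH ROW** (`κ > 5`; Robinson–Sadowski–Silva's
`‖u‖_{F¹} ≤ c ‖u‖₂^{1−5/(2s)} ‖u‖_{Ḣ^s}^{5/(2s)}` in dyadic currency). For every `κ > 5` there is `C = C_κ > 0` such that
for every `v ∈ L²(ℝ³)` whose `κ`-row is finite:
`∑_l 2^{5l/2} ‖Δ̇_l v‖₂ ≤ C · ‖v‖₂^{(κ−5)/κ} · (∑_j 2^{κj} ‖Δ̇_j v‖₂²)^{5/(2κ)}` (real numbers; `lipRow_le_head_add_tail` at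
every level and `dyadic_optimisation_p` with `p = 5/2`, `θ = (κ−5)/2`). [cite: RobinsonSadowskiSilva2012, §III (3.10)]
[cite: BahouriCheminDanchin2011, Prop. 2.22] -/
theorem lipRow_le_interpolate {κ : ℝ} (hκ : 5 < κ) :
    ∃ C : ℝ, 0 < C ∧ ∀ (v : EuclideanSpace ℝ (Fin 3) → EuclideanSpace ℝ (Fin 3)), MemLp v 2 volume →
      ∑' j : ℤ, (2 : ℝ≥0∞) ^ (κ * (j : ℝ)) * blockL2 v j ^ 2 ≠ ∞ →
      (∑' l : ℤ, (2 : ℝ≥0∞) ^ ((5 / 2 : ℝ) * (l : ℝ)) * blockL2 v l).toReal ≤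
        C * (eLpNorm v 2 volume).toReal ^ ((κ - 5) / κ) *
          (∑' j : ℤ, (2 : ℝ≥0∞) ^ (κ * (j : ℝ)) * blockL2 v j ^ 2).toReal ^ (5 / (2 * κ)) := by
  set K := lpBounds (Fin 3) with hK
  set θ : ℝ := (κ - 5) / 2 with hθ
  have hθ0 : 0 < θ := by rw [hθ]; linarith
  set G : ℝ≥0∞ := ∑' n : ℕ, ((2 : ℝ≥0∞) ^ (-(5 / 2 : ℝ))) ^ n with hG
  set Gk : ℝ≥0∞ := ∑' n : ℕ, ((2 : ℝ≥0∞) ^ (5 - κ)) ^ n with hGk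
  have hGtop : G ≠ ∞ := (tsum_geom_lt_top (by norm_num)).ne
  have hGktop : Gk ≠ ∞ := (geom_lt_top_of_neg (by linarith : 5 - κ < 0)).ne
  -- real constants
  set α₀ : ℝ := (K.C₂ : ℝ) * ((2 : ℝ) ^ (-(5 / 2 : ℝ))) * G.toReal with hα₀
  set β : ℝ := Gk.toReal ^ (1 / 2 : ℝ) + 1 with hβ
  have hα₀0 : 0 ≤ α₀ := by positivity
  have hβ0 : 0 < β := by positivity
  -- the exponents
  have hκ0 : 0 < κ := by linarith
  have e1 : 2 + 2 * θ / (5 / 2) = 2 * κ / 5 := by rw [hθ]; ring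
  have e2 : 2 * θ / (5 / 2) = (2 * κ - 10) / 5 := by rw [hθ]; ring
  set Cbig : ℝ := (2 : ℝ) ^ (2 + 2 * θ + (2 * κ - 10) / 5) * α₀ ^ ((2 * κ - 10) / 5) * β ^ 2 + 1 with hCbig
  have hCbig0 : 0 < Cbig := by positivity
  refine ⟨Cbig ^ (5 / (2 * κ)), by positivity, fun v hv hY => ?_⟩
  set P : ℝ≥0∞ := ∑' l : ℤ, (2 : ℝ≥0∞) ^ ((5 / 2 : ℝ) * (l : ℝ)) * blockL2 v l with hP
  set Y : ℝ≥0∞ := ∑' j : ℤ, (2 : ℝ≥0∞) ^ (κ * (j : ℝ)) * blockL2 v j ^ 2 with hY'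
  set E : ℝ := (eLpNorm v 2 volume).toReal with hE
  have hE0 : 0 ≤ E := ENNReal.toReal_nonneg
  have hPtop : P ≠ ∞ := lipRow_ne_top hv hκ hY
  have hEtop : eLpNorm v 2 volume ≠ ∞ := hv.eLpNorm_ne_top
  -- the real inequality at every level
  have hJ : ∀ J : ℤ, P.toReal ≤ (α₀ * E) * (2 : ℝ) ^ ((5 / 2 : ℝ) * J) + β * (2 : ℝ) ^ (-θ * J) * Real.sqrt Y.toReal := by
    intro J
    have h := lipRow_le_head_add_tail hv κ J
    have hA : (K.C₂ : ℝ≥0∞) * eLpNorm v 2 volume * (2 : ℝ≥0∞) ^ ((5 / 2 : ℝ) * ((J - 1 : ℤ) : ℝ)) * G ≠ ∞ :=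
      ENNReal.mul_ne_top (ENNReal.mul_ne_top (ENNReal.mul_ne_top ENNReal.coe_ne_top hEtop) (RiccatiSlice.two_rpow_ne_top _)) hGtop
    have hB : ((2 : ℝ≥0∞) ^ ((5 - κ) * (J : ℝ)) * Gk) ^ (1 / 2 : ℝ) * Y ^ (1 / 2 : ℝ) ≠ ∞ :=
      ENNReal.mul_ne_top (ENNReal.rpow_ne_top_of_nonneg (by norm_num) (ENNReal.mul_ne_top (RiccatiSlice.two_rpow_ne_top _) hGktop))
        (ENNReal.rpow_ne_top_of_nonneg (by norm_num) hY)
    have h' := ENNReal.toReal_mono (ENNReal.add_ne_top.2 ⟨hA, hB⟩) h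
    rw [ENNReal.toReal_add hA hB] at h'
    have hAr : ((K.C₂ : ℝ≥0∞) * eLpNorm v 2 volume * (2 : ℝ≥0∞) ^ ((5 / 2 : ℝ) * ((J - 1 : ℤ) : ℝ)) * G).toReal =
        (α₀ * E) * (2 : ℝ) ^ ((5 / 2 : ℝ) * J) := by
      rw [ENNReal.toReal_mul, ENNReal.toReal_mul, ENNReal.toReal_mul, ← ENNReal.toReal_rpow, ENNReal.toReal_ofNat,
        ENNReal.coe_toReal, hα₀, hE]
      have : (2 : ℝ) ^ ((5 / 2 : ℝ) * ((J - 1 : ℤ) : ℝ)) = (2 : ℝ) ^ (-(5 / 2 : ℝ)) * (2 : ℝ) ^ ((5 / 2 : ℝ) * J) := by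
        rw [← Real.rpow_add two_pos]; congr 1; push_cast; ring
      rw [this]; ring
    have hBr : (((2 : ℝ≥0∞) ^ ((5 - κ) * (J : ℝ)) * Gk) ^ (1 / 2 : ℝ) * Y ^ (1 / 2 : ℝ)).toReal ≤
        β * (2 : ℝ) ^ (-θ * J) * Real.sqrt Y.toReal := by
      rw [ENNReal.toReal_mul, ← ENNReal.toReal_rpow, ← ENNReal.toReal_rpow, ENNReal.toReal_mul,
        ← ENNReal.toReal_rpow, ENNReal.toReal_ofNat, Real.sqrt_eq_rpow,
        Real.mul_rpow (by positivity) ENNReal.toReal_nonneg, ← Real.rpow_mul (by norm_num),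
        show (5 - κ) * (J : ℝ) * (1 / 2) = -θ * J by rw [hθ]; ring]
      have hG1 : Gk.toReal ^ (1 / 2 : ℝ) ≤ β := by rw [hβ]; linarith
      calc (2 : ℝ) ^ (-θ * J) * Gk.toReal ^ (1 / 2 : ℝ) * Y.toReal ^ (1 / 2 : ℝ)
          ≤ (2 : ℝ) ^ (-θ * J) * β * Y.toReal ^ (1 / 2 : ℝ) := by gcongr
        _ = β * (2 : ℝ) ^ (-θ * J) * Y.toReal ^ (1 / 2 : ℝ) := by ring
    linarith [h', hAr.le, hAr.ge, hBr]
  -- optimise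
  rcases (ENNReal.toReal_nonneg : 0 ≤ P.toReal).eq_or_lt with hP0 | hPpos
  · rw [← hP0]
    positivity
  have hopt := dyadic_optimisation_p hPpos (by positivity) hβ0 ENNReal.toReal_nonneg hθ0
    (by norm_num : (0 : ℝ) < 5 / 2) hJ
  rw [e1, e2] at hopt
  -- `P^{2κ/5} ≤ Cbig · (α₀E)^{(2κ−10)/5} · Y`, then take the `5/(2κ)`-th power
  have hle : P.toReal ^ (2 * κ / 5) ≤ Cbig * (E ^ ((2 * κ - 10) / 5) * Y.toReal) := by
    calc P.toReal ^ (2 * κ / 5)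
        ≤ (2 : ℝ) ^ (2 + 2 * θ + (2 * κ - 10) / 5) * (α₀ * E) ^ ((2 * κ - 10) / 5) * β ^ 2 * Y.toReal := hopt
      _ = ((2 : ℝ) ^ (2 + 2 * θ + (2 * κ - 10) / 5) * α₀ ^ ((2 * κ - 10) / 5) * β ^ 2) *
            (E ^ ((2 * κ - 10) / 5) * Y.toReal) := by
          rw [Real.mul_rpow hα₀0 hE0]; ring
      _ ≤ Cbig * (E ^ ((2 * κ - 10) / 5) * Y.toReal) := by
          refine mul_le_mul_of_nonneg_right ?_ (by positivity)
          rw [hCbig]; linarith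
  have hq : 0 < 5 / (2 * κ) := by positivity
  have hroot := Real.rpow_le_rpow (by positivity) hle hq.le
  rw [← Real.rpow_mul ENNReal.toReal_nonneg, show 2 * κ / 5 * (5 / (2 * κ)) = 1 by field_simp,
    Real.rpow_one, Real.mul_rpow hCbig0.le (by positivity), Real.mul_rpow (by positivity) ENNReal.toReal_nonneg,
    ← Real.rpow_mul hE0, show (2 * κ - 10) / 5 * (5 / (2 * κ)) = (κ - 5) / κ by field_simp; ring] at hroot
  calc P.toReal ≤ Cbig ^ (5 / (2 * κ)) * (E ^ ((κ - 5) / κ) * Y.toReal ^ (5 / (2 * κ))) := hroot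
    _ = _ := by ring

end Summit.NavierStokesRegularity.FluidComputer.LipschitzRowInterpolation

end
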